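import Summits.Ventures.PackingBounds.Energy.FivePointRieszTwoSquares
import HarnessLib

/-!
# Five points on `S²`, Riesz 2-energy: nonnegativity and the sum-of-squares identity of the certificate

Framing: lottery ticket; floor = certified bounds/negative ranges. Venture `PackingBounds`, cell
`pub-packcert`, energy family E3PT (pub-packcert-energy gen 10).
-/

noncomputable section

namespace Summit.Ventures.PackingBounds.Energy.FivePointRieszTwo

set_option maxRecDepth 20000 in
/-- The chunk `sqPart0` is a nonnegative combination of squares. -/
theorem sqPart0_nonneg (u v t : ℝ) : 0 ≤ sqPart0 u v t := by
  unfold sqPart0; positivity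

set_option maxRecDepth 20000 in
/-- The chunk `sqPart1` is a nonnegative combination of squares. -/
theorem sqPart1_nonneg (u v t : ℝ) : 0 ≤ sqPart1 u v t := by
  unfold sqPart1; positivity

set_option maxRecDepth 20000 in
/-- The chunk `sqPart2` is a nonnegative combination of squares. -/
theorem sqPart2_nonneg (u v t : ℝ) : 0 ≤ sqPart2 u v t := by
  unfold sqPart2; positivity

set_option maxRecDepth 20000 in
/-- The chunk `sqPart3` is a nonnegative combination of squares. -/
theorem sqPart3_nonneg (u v t : ℝ) : 0 ≤ sqPart3 u v t := by
  unfold sqPart3; positivity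

set_option maxRecDepth 20000 in
/-- The chunk `prPart0` is a nonnegative combination of squares. -/
theorem prPart0_nonneg (u v t : ℝ) : 0 ≤ prPart0 u v t := by
  unfold prPart0; positivity

set_option maxRecDepth 20000 in
/-- The chunk `prPart1` is a nonnegative combination of squares. -/
theorem prPart1_nonneg (u v t : ℝ) : 0 ≤ prPart1 u v t := by
  unfold prPart1; positivity

set_option maxRecDepth 20000 in
/-- The chunk `prPart2` is a nonnegative combination of squares. -/
theorem prPart2_nonneg (u v t : ℝ) : 0 ≤ prPart2 u v t := by
  unfold prPart2; positivity

set_option maxRecDepth 20000 in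
/-- The chunk `prPart3` is a nonnegative combination of squares. -/
theorem prPart3_nonneg (u v t : ℝ) : 0 ≤ prPart3 u v t := by
  unfold prPart3; positivity

set_option maxRecDepth 20000 in
/-- The chunk `prPart4` is a nonnegative combination of squares. -/
theorem prPart4_nonneg (u v t : ℝ) : 0 ≤ prPart4 u v t := by
  unfold prPart4; positivity

set_option maxRecDepth 20000 in
/-- The chunk `prPart5` is a nonnegative combination of squares. -/
theorem prPart5_nonneg (u v t : ℝ) : 0 ≤ prPart5 u v t := by
  unfold prPart5; positivity

set_option maxRecDepth 20000 in
/-- The chunk `prPart6` is a nonnegative combination of squares. -/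
theorem prPart6_nonneg (u v t : ℝ) : 0 ≤ prPart6 u v t := by
  unfold prPart6; positivity

set_option maxRecDepth 20000 in
/-- The chunk `prPart7` is a nonnegative combination of squares. -/
theorem prPart7_nonneg (u v t : ℝ) : 0 ≤ prPart7 u v t := by
  unfold prPart7; positivity

set_option maxRecDepth 20000 in
/-- The chunk `prPart8` is a nonnegative combination of squares. -/
theorem prPart8_nonneg (u v t : ℝ) : 0 ≤ prPart8 u v t := by
  unfold prPart8; positivity

set_option maxRecDepth 20000 in
/-- The chunk `dgPart` is a nonnegative combination of squares. -/
theorem dgPart_nonneg (u v t : ℝ) : 0 ≤ dgPart u v t := by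
  unfold dgPart; positivity

/-- The slack polynomial is nonnegative everywhere (it is a weighted sum of squares). -/
theorem sosR_nonneg (u v t : ℝ) : 0 ≤ sosR u v t := by
  unfold sosR
  linarith [sqPart0_nonneg u v t, sqPart1_nonneg u v t, sqPart2_nonneg u v t, sqPart3_nonneg u v t, prPart0_nonneg u v t, prPart1_nonneg u v t, prPart2_nonneg u v t, prPart3_nonneg u v t, prPart4_nonneg u v t, prPart5_nonneg u v t, prPart6_nonneg u v t, prPart7_nonneg u v t, prPart8_nonneg u v t, dgPart_nonneg u v t]

set_option maxRecDepth 20000 in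
set_option maxHeartbeats 400000000 in
/-- The sum-of-squares identity of the certificate: the slack of the three-point inequality is `sosR`. -/
theorem sos_identity (u v t : ℝ) :
    (pmin u + pmin v + pmin t) / 3 - (c0 + 3 * Fexp u v t + Fexp u u 1 + Fexp v v 1 + Fexp t t 1
      + (a1 * u + a1 * v + a1 * t) / 3) = sosR u v t := by
  unfold pmin Fexp sosR c0 a1 sqPart0 sqPart1 sqPart2 sqPart3 prPart0 prPart1 prPart2 prPart3 prPart4 prPart5 prPart6 prPart7 prPart8 dgPart
  ring

end Summit.Ventures.PackingBounds.Energy.FivePointRieszTwo
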